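import Summits.NavierStokesRegularity.NavierStokesRegularity.Theorems.FilamentSkeletonRssCoreLinearInvertibilityEvenArnoldTools
import Summits.NavierStokesRegularity.NavierStokesRegularity.Theorems.FilamentSkeletonRssCoreLinearInvertibilityOddArnoldToolsC
import Summits.NavierStokesRegularity.NavierStokesRegularity.Theorems.FilamentSkeletonRssCoreLinearInvertibilityOddSymmetrizerBoundsClass
import Literature.Analysis.FluidPDE.GaussianVortexKernelRadial
import Literature.Analysis.FluidPDE.PlanarPolarCoords

/-!
# Crux `CoreLinearInvertibility` (stmt-NavierStokesRegularity-17973), line `Sketch`, stub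
# `stub_evenSymmetrizerBoundedBelow`: the symmetrizer is bounded below on EVEN circular-mean-free
# vorticities (explicit Arnold coercivity for the angular modes `|k| ≥ 2`, transferred to `X_λ`)

For `λ ∈ (0,1)` there is `C > 0` such that every EVEN `C²_c` vorticity `w` with ZERO CIRCULAR MEANS
(`∫_{−π}^{π} w(r cos θ, r sin θ) dθ = 0` for `r > 0`) obeys `∫ G_λ⁻¹ w² ≤ C² ∫ G_λ⁻¹ (w + u)²`,
`u = Φ(|x|) ψ`, `ψ = N ∗ w` (`N = (2π)⁻¹ log|·|`, `Φ = kerWeight`, `G_λ = gaussWeightLam λ`) — the body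
of the registered stub `stub_evenSymmetrizerBoundedBelow` of the skeleton
`Cruxes/CoreLinearInvertibility/Lines/Sketch.lean` (wave 3, even sector). Unlike the odd twin
(`…OddArnold`, which consumes the Gallay–Šverák fact), the coercivity of Arnold's form used here is
EXPLICIT and proved in the tree (`evenArnold_coercive`, file `…EvenArnoldTools`): on even
circular-mean-free densities `2J(a) = ∫ Φ⁻¹a² + ∫ a ψ_a ≥ (3/10) ∫ Φ⁻¹ a²` (Hardy–Wirtinger `¼` and
`Φ|x|² ≤ 14/5`), and the kernel of `I − K̃` on such densities is trivial (no moment correction).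

Transfer (`K̃a = −Φψ_a`, `f = w + u = (I − K̃)w`, `g = −u = K̃w`, so `w = f + g`):
* `w ∈ C²_c` is of Gaussian class; `ψ = ψ_w` is even with zero circular means (tree
  `logPotential_neg`, `logPotential_circMean_eq_zero`), so `u = Φψ ∈ C²` is even, circular-mean-free
  and of second-order Gaussian class (`oddSym_u_class`); hence `g = −u ∈ C¹` is even,
  circular-mean-free, with `|g|, ‖Dg‖` of Gaussian class, and `f` is continuous of Gaussian class;
* linearity of `a ↦ ψ_a` on `X_λ`: `ψ_w = ψ_f + ψ_g`, hence `(I − K̃)g = g + Φψ_g = −Φψ_f = K̃ f`;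
* `evenArnold_kerNorm_le`: `‖g‖_{L²(Φ⁻¹)} ≤ (10/3) ‖Φψ_f‖_{L²(Φ⁻¹)} ≤ (10/3) √K ‖f‖_{X_λ}`
  (`∫ Φ ψ_f² ≤ K ‖f‖²_{X_λ}`, tools B of the odd stub);
* `λ > 0`: `G_λ⁻¹ ≤ (4π/(λ(1−λ))) Φ⁻¹`, so `‖g‖_{X_λ} ≤ √(4π/(λ(1−λ))) ‖g‖_{L²(Φ⁻¹)}`, and Minkowski:
  `‖w‖_{X_λ} ≤ ‖f‖_{X_λ} + ‖g‖_{X_λ} ≤ (1 + √(4π/(λ(1−λ))) (10/3) √K) ‖f‖_{X_λ}`.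

References: Th. Gallay, V. Šverák, arXiv:2110.13739, §2, Thm. 2.5, §4.1 (Arnold's form at the
Gaussian, weight `𝒜 = 1/Φ`); Y. Maekawa, J. Math. Fluid Mech. 13 (2011) / Th. Gallay, Y. Maekawa,
arXiv:1610.08384, Lemma 2.7 (the symmetrizer weight `Φ = G/(2Ω)`); Th. Gallay, C. E. Wayne,
Comm. Math. Phys. 255 (2005) §4.1. Folklore otherwise.
-/

set_option linter.dupNamespace false

noncomputable section

namespace Summit.NavierStokesRegularity.NavierStokesRegularity.Theorems

open Set Function Filter MeasureTheory Topology Metric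
open Literature.Analysis.FluidPDE
open Summit.AnomalousDissipation.AnomalousDissipation.Theorems.MarginalStabilityChainStretchedVortexRows
open scoped InnerProductSpace

/-- **Registered stub `stub_evenSymmetrizerBoundedBelow`** (crux stmt-NavierStokesRegularity-17973, line
`Sketch`): the symmetrizer `w ↦ w + Φψ_w` is bounded below in `X_λ`, `0 < λ < 1`, on EVEN `C²_c`
vorticities with zero circular means: `∫ G_λ⁻¹ w² ≤ C² ∫ G_λ⁻¹ (w + u)²`, `ψ = (2π)⁻¹ log|·| ∗ w`,
`u = Φ(|x|) ψ`. Explicit Arnold coercivity (`evenArnold_kerNorm_le`) transferred to `X_λ`. -/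
theorem stub_evenSymmetrizerBoundedBelow :
    ∀ lam ∈ Set.Ioo (0 : ℝ) 1, ∃ C : ℝ, 0 < C ∧
    ∀ (w ψ u : EuclideanSpace ℝ (Fin 2) → ℝ), ContDiff ℝ 2 w → HasCompactSupport w →
    (∀ x, w (-x) = w x) →
    (∀ r : ℝ, 0 < r → ∫ θ in (-Real.pi)..Real.pi, w (circlePt r θ) = 0) →
    (∀ x, ψ x = ∫ y, (2 * Real.pi)⁻¹ * Real.log ‖x - y‖ * w y) →
    (∀ x, u x = kerWeight ‖x‖ * ψ x) →
    ∫ x, (gaussWeightLam lam x)⁻¹ * w x ^ 2 ≤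
      C ^ 2 * ∫ x, (gaussWeightLam lam x)⁻¹ * (w x + u x) ^ 2 := by
  intro lam hlam
  obtain ⟨h0, h1⟩ := hlam
  obtain ⟨K₁, hK₁, hpot⟩ := arnold_logPotential_bound h1
  obtain ⟨K₂, hK₂, hsq⟩ := arnold_integral_kerWeight_mul_logPotential_sq_le h1
  set Kl : ℝ := 4 * Real.pi / (lam * (1 - lam)) with hKl
  have hl1 : 0 < 1 - lam := by linarith
  have hKl0 : 0 ≤ Kl := by rw [hKl]; positivity
  set B : ℝ := 10 / 3 * Real.sqrt K₂ with hB
  have hB0 : 0 ≤ B := by positivity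
  refine ⟨1 + Real.sqrt Kl * B, by positivity, fun w ψ u hw hws heven hcirc hψ hu => ?_⟩
  -- Step 1: the data `w`, `ψ = ψ_w` (even, circular-mean-free), `u = Φ ψ`
  have hwc : Continuous w := hw.continuous
  have hwm : AEStronglyMeasurable w volume := hwc.aestronglyMeasurable
  have hwg := arnold_gc_of_hasCompactSupport hwc hws
  have hwX := arnold_integrable_inv_gaussWeightLam_mul_sq h0.le h1 hwm hwg
  have hψe : ∀ x, ψ (-x) = ψ x := fun x => by
    rw [hψ, hψ]; exact logPotential_neg heven x
  obtain ⟨Bw, -, hBw⟩ := arnold_gaussBound_of_hasCompactSupport hwc hws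
  have hwb' : ∀ η, |w η| ≤ Bw * Real.exp (-(1 / 8) * ‖η‖ ^ 2) := fun η => by
    rw [← Real.norm_eq_abs]; exact hBw η
  have hcircAD : ∀ r, 0 < r →
      ∫ θ in (0:ℝ)..(2 * Real.pi), w (WithLp.toLp 2 ![r * Real.cos θ, r * Real.sin θ]) = 0 :=
    fun r hr => by rw [evenArnold_circMean_zero_two_pi, hcirc r hr]
  have hψcirc : ∀ r : ℝ, 0 < r → ∫ θ in (-Real.pi)..Real.pi, ψ (circlePt r θ) = 0 := by
    intro r hr
    have h := logPotential_circMean_eq_zero hwc hwb' hcircAD r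
    rw [evenArnold_circMean_zero_two_pi
      (fun ξ => ∫ η, (2 * Real.pi)⁻¹ * Real.log ‖ξ - η‖ * w η) r] at h
    simp_rw [hψ]
    exact h
  have huC2 : ContDiff ℝ 2 u := oddSym_u_contDiff hw hws hψ hu
  obtain ⟨Cu, Nu, -, huCl⟩ := oddSym_u_class hw hws hψ hu
  have huc : Continuous u := huC2.continuous
  have hug : ∃ (C : ℝ) (N : ℕ), ∀ x, |u x| ≤ C * (1 + ‖x‖) ^ N * Real.exp (-(‖x‖ ^ 2 / 4)) :=
    ⟨Cu, Nu, fun x => (huCl x).1⟩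
  have hue : ∀ x, u (-x) = u x := fun x => by rw [hu, hu, norm_neg, hψe]
  have hucirc : ∀ r : ℝ, 0 < r → ∫ θ in (-Real.pi)..Real.pi, u (circlePt r θ) = 0 := by
    intro r hr
    have e : (fun θ => u (circlePt r θ)) = fun θ => kerWeight r * ψ (circlePt r θ) := by
      funext θ; rw [hu, norm_circlePt, kerWeight_abs]
    rw [e, intervalIntegral.integral_const_mul, hψcirc r hr, mul_zero]
  -- Step 2: `f = w + u = (I − K̃)w`, `g = −u = K̃ w`, `w = f + g`
  set f : EuclideanSpace ℝ (Fin 2) → ℝ := fun x => w x + u x with hf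
  set g : EuclideanSpace ℝ (Fin 2) → ℝ := fun x => -u x with hg
  have hfc : Continuous f := hwc.add huc
  have hgc : Continuous g := huc.neg
  have hgC1 : ContDiff ℝ 1 g := huC2.neg.of_le one_le_two
  have hge : ∀ x, g (-x) = g x := fun x => by simp only [hg, hue]
  have hgcirc : ∀ r : ℝ, 0 < r → ∫ θ in (-Real.pi)..Real.pi, g (circlePt r θ) = 0 := by
    intro r hr
    simp only [hg]
    rw [intervalIntegral.integral_neg, hucirc r hr, neg_zero]
  have hgb : ∃ (C : ℝ) (N : ℕ), ∀ x, |g x| ≤ C * (1 + ‖x‖) ^ N * Real.exp (-(‖x‖ ^ 2 / 4)) ∧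
      ‖fderiv ℝ g x‖ ≤ C * (1 + ‖x‖) ^ N * Real.exp (-(‖x‖ ^ 2 / 4)) := by
    refine ⟨Cu, Nu, fun x => ⟨?_, ?_⟩⟩
    · simp only [hg, abs_neg]; exact (huCl x).1
    · simp only [hg, fderiv_fun_neg, norm_neg]; exact (huCl x).2.1
  have hfm : AEStronglyMeasurable f volume := hfc.aestronglyMeasurable
  have hgm : AEStronglyMeasurable g volume := hgc.aestronglyMeasurable
  have hfg : ∃ (C : ℝ) (N : ℕ), ∀ x, |f x| ≤ C * (1 + ‖x‖) ^ N * Real.exp (-(‖x‖ ^ 2 / 4)) :=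
    arnold_gc_add hwg hug
  have hgg : ∃ (C : ℝ) (N : ℕ), ∀ x, |g x| ≤ C * (1 + ‖x‖) ^ N * Real.exp (-(‖x‖ ^ 2 / 4)) :=
    arnold_gc_neg hug
  have hfX := arnold_integrable_inv_gaussWeightLam_mul_sq h0.le h1 hfm hfg
  have hgX := arnold_integrable_inv_gaussWeightLam_mul_sq h0.le h1 hgm hgg
  have hgΦ := arnold_integrable_inv_kerWeight_mul_sq hgm hgg
  set Sf : ℝ := Real.sqrt (∫ x, (gaussWeightLam lam x)⁻¹ * f x ^ 2) with hSf
  have hSf0 : 0 ≤ Sf := Real.sqrt_nonneg _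
  -- Step 3: `(I − K̃) g = K̃ f`, i.e. `g + Φ ψ_g = −Φ ψ_f` (linearity of the potential)
  set ψf : EuclideanSpace ℝ (Fin 2) → ℝ :=
    fun x => ∫ y, (2 * Real.pi)⁻¹ * Real.log ‖x - y‖ * f y with hψf
  set ψg : EuclideanSpace ℝ (Fin 2) → ℝ :=
    fun x => ∫ y, (2 * Real.pi)⁻¹ * Real.log ‖x - y‖ * g y with hψg
  have hif : ∀ x, Integrable fun y => (2 * Real.pi)⁻¹ * Real.log ‖x - y‖ * f y := fun x =>
    (hpot f hfm hfX x).1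
  have hig : ∀ x, Integrable fun y => (2 * Real.pi)⁻¹ * Real.log ‖x - y‖ * g y := fun x =>
    (hpot g hgm hgX x).1
  have hψsplit : ∀ x, ψ x = ψf x + ψg x := by
    intro x
    rw [hψ x]
    have e : (fun y => (2 * Real.pi)⁻¹ * Real.log ‖x - y‖ * w y) =
        fun y => (2 * Real.pi)⁻¹ * Real.log ‖x - y‖ * (f y + g y) := by
      funext y; simp only [hf, hg]; ring
    rw [e]
    exact arnold_logPotential_add (hif x) (hig x)
  have hrel : ∀ x, g x + kerWeight ‖x‖ * ψg x = -(kerWeight ‖x‖ * ψf x) := by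
    intro x
    simp only [hg]
    rw [hu x, hψsplit x]
    ring
  -- Step 4: the explicit Arnold coercivity: `‖g‖_Φ ≤ (10/3) ‖Φ ψ_f‖_Φ ≤ B ‖f‖_λ`
  have hΦc : Continuous fun x : EuclideanSpace ℝ (Fin 2) => kerWeight ‖x‖ :=
    continuous_kerWeight.comp continuous_norm
  have hψfm : AEStronglyMeasurable ψf volume := arnold_aestronglyMeasurable_logPotential hfm
  have hFm : AEStronglyMeasurable (fun x => -(kerWeight ‖x‖ * ψf x)) volume :=
    (hΦc.aestronglyMeasurable.mul hψfm).neg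
  have hψfb : ∀ x, |ψf x| ≤ K₁ * Sf * (1 + ‖x‖) ^ 1 := fun x =>
    (hpot f hfm hfX x).2.trans_eq (by rw [hSf]; ring)
  have hFg : ∃ (C : ℝ) (N : ℕ), ∀ x, |-(kerWeight ‖x‖ * ψf x)| ≤
      C * (1 + ‖x‖) ^ N * Real.exp (-(‖x‖ ^ 2 / 4)) :=
    arnold_gc_neg (arnold_gc_kerWeight_mul hψfb)
  have hcoer := evenArnold_kerNorm_le hgC1 hgb hge hgcirc (fun x => rfl) hFm hFg hrel
  obtain ⟨-, hKfle⟩ := hsq f ψf hfm hfX (fun x => rfl)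
  have hFn : Real.sqrt (∫ x, (kerWeight ‖x‖)⁻¹ * (-(kerWeight ‖x‖ * ψf x)) ^ 2) ≤ Real.sqrt K₂ * Sf := by
    have e : ∫ x, (kerWeight ‖x‖)⁻¹ * (-(kerWeight ‖x‖ * ψf x)) ^ 2 =
        ∫ x, (kerWeight ‖x‖)⁻¹ * (kerWeight ‖x‖ * ψf x) ^ 2 :=
      integral_congr_ae (Eventually.of_forall fun x => by simp only [neg_sq])
    rw [e, hSf, ← Real.sqrt_mul hK₂.le]
    exact Real.sqrt_le_sqrt hKfle
  have hgn : Real.sqrt (∫ x, (kerWeight ‖x‖)⁻¹ * g x ^ 2) ≤ B * Sf := by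
    refine hcoer.trans ?_
    rw [hB, mul_assoc]
    exact mul_le_mul_of_nonneg_left hFn (by norm_num)
  -- Step 5: `‖g‖_λ ≤ √K_λ ‖g‖_Φ` (this is where `λ > 0` enters) and `‖w‖_λ ≤ ‖f‖_λ + ‖g‖_λ`
  have hgl : Real.sqrt (∫ x, (gaussWeightLam lam x)⁻¹ * g x ^ 2) ≤
      Real.sqrt Kl * Real.sqrt (∫ x, (kerWeight ‖x‖)⁻¹ * g x ^ 2) :=
    arnold_sqrt_integral_weight_mul_sq_le_of_le hKl0 (fun x => inv_nonneg.2 (gaussWeightLam_pos h1 x).le)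
      (arnold_inv_gaussWeightLam_le h0 h1) hgΦ
  have hGinv : ∀ x, 0 ≤ (gaussWeightLam lam x)⁻¹ := fun x => inv_nonneg.2 (gaussWeightLam_pos h1 x).le
  obtain ⟨-, hMinkw⟩ := arnold_sqrt_integral_weight_mul_add_sq_le (μ := volume) (a := f) (b := g) hGinv
    (continuous_inv_gaussWeightLam h1).aestronglyMeasurable hfm hgm hfX hgX
  have hwn : Real.sqrt (∫ x, (gaussWeightLam lam x)⁻¹ * w x ^ 2) ≤
      Sf + Real.sqrt (∫ x, (gaussWeightLam lam x)⁻¹ * g x ^ 2) := by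
    have e : ∫ x, (gaussWeightLam lam x)⁻¹ * w x ^ 2 = ∫ x, (gaussWeightLam lam x)⁻¹ * (f x + g x) ^ 2 :=
      integral_congr_ae (Eventually.of_forall fun x => by simp only [hf, hg]; ring)
    rw [e]; exact hMinkw
  -- Step 6: bookkeeping
  have hchain : Real.sqrt (∫ x, (gaussWeightLam lam x)⁻¹ * w x ^ 2) ≤ (1 + Real.sqrt Kl * B) * Sf := by
    have hsK : 0 ≤ Real.sqrt Kl := Real.sqrt_nonneg _
    have u2 := mul_le_mul_of_nonneg_left hgn hsK
    calc Real.sqrt (∫ x, (gaussWeightLam lam x)⁻¹ * w x ^ 2)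
        ≤ Sf + Real.sqrt Kl * Real.sqrt (∫ x, (kerWeight ‖x‖)⁻¹ * g x ^ 2) := hwn.trans (by linarith [hgl])
      _ ≤ Sf + Real.sqrt Kl * (B * Sf) := by linarith
      _ = (1 + Real.sqrt Kl * B) * Sf := by ring
  have hW0 : 0 ≤ ∫ x, (gaussWeightLam lam x)⁻¹ * w x ^ 2 :=
    integral_nonneg fun x => mul_nonneg (hGinv x) (sq_nonneg _)
  have hF0 : 0 ≤ ∫ x, (gaussWeightLam lam x)⁻¹ * f x ^ 2 :=
    integral_nonneg fun x => mul_nonneg (hGinv x) (sq_nonneg _)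
  have hsq2 := pow_le_pow_left₀ (Real.sqrt_nonneg _) hchain 2
  rw [Real.sq_sqrt hW0, mul_pow, hSf, Real.sq_sqrt hF0] at hsq2
  exact hsq2

end Summit.NavierStokesRegularity.NavierStokesRegularity.Theorems
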